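import Summits.AtomisticToContinuum.BoseEinsteinCondensation.Theorems.BECGroundStateSOSPeriodicIRBoundDefs
import Summits.AtomisticToContinuum.BoseEinsteinCondensation.Theorems.BECGroundStateSOSPeriodicIRBoundWFDefs
import Summits.AtomisticToContinuum.BoseEinsteinCondensation.Theorems.BECGroundStateSOSPeriodicIRBoundWFPotCross
import Summits.AtomisticToContinuum.BoseEinsteinCondensation.Theorems.BECGroundStateSOSPeriodicIRBoundWFPolar
import Literature.MathematicalPhysics.QuantumManyBody.PeriodicBoseGasMomentumSector
import Literature.MathematicalPhysics.QuantumManyBody.TorusFockLayer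
import Literature.MathematicalPhysics.QuantumManyBody.TorusFockSectorInteraction
import Literature.MathematicalPhysics.QuantumManyBody.PeriodicFormDomain
import Literature.MathematicalPhysics.QuantumManyBody.PeriodicBoseGasTagged
import Literature.MathematicalPhysics.QuantumManyBody.PeriodicBoseGasRelabelling
import Mathlib.MeasureTheory.Integral.Bochner.ContinuousLinearMap
import HarnessLib

/-! # Crux `PeriodicIRBound` (stmt-AtomisticToContinuum-3972), line `linear-ph-floor-wagner`, stub 5b `stub_wagnerFeynman` — PotCross2
The potential cross term, part 2 (P-a): `potRe_w(Φ, n̂_kΦ) = P[a_kΦ] + (m+1) ∑_b Re s_b`. -/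

/-!

`linear-ph-floor-wagner` (crux stmt-AtomisticToContinuum-3972). Depends on `WFPotCross.lean` (whose results are

* `potRe_numOp` (P-a): for a core `(m+1)`-body `Φ`, `φ = planeWaveMode L k`, `h = sliceCoef L k Φ` (`aΦ = √(m+1) h`)
  and `n̂Φ = a†(φ)a(φ)Φ = ∑_j φ(x_j) h(X̂_j)` (`PotCross.numOp_apply`),
  `potRe_w(Φ, n̂Φ) = P_w[aΦ].toReal + (m+1) ∑_b Re s_b`:
  `potRe = Re ∫ ∑_j G_j` (`PotCross.potRe_numOp_eq_re`); the `m+1` terms contribute equally by relabelling symmetry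
  (`PotCross.integral_crossG_eq`: TK2 and `vecCons_self_removeNth_comp_cycleRange`); for `j = 0`, Bochner–Fubini in
  the first particle (TK1), the inner computation of part 1, and `(m+1) ∫_Y W|h|² = P_w[aΦ]`
  (`PotCross.toReal_potForm_modeAn`).

-/

noncomputable section

open scoped BigOperators ENNReal ComplexConjugate
open Filter MeasureTheory

namespace Summit.AtomisticToContinuum.BoseEinsteinCondensation.Cruxes.PeriodicIRBound.LinearPhFloorWagner.WF

open Literature.MathematicalPhysics.QuantumManyBody.BoseGas

variable {M m n : ℕ} {L : ℝ}

-- imports `WFPotCross`)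

namespace PotCross

end PotCross

namespace PotCross

/-! ## Unfolding `n̂Φ` and the relabelling symmetry of the cross densities -/

/-- (0) `n̂Φ = a†(φ)a(φ)Φ = ∑_j φ(x_j) h(X̂_j)` with `h = sliceCoef L k Φ`: the prefactors
`(√(m+1))⁻¹ · √(m+1)` of `modeCr`/`modeAn` cancel. -/
theorem numOp_apply (L : ℝ) (k : Fin 3 → ℤ) (Φ : Config (m + 1) → ℂ) (X : Config (m + 1)) :
    modeCr (planeWaveMode L k) (modeAn L (planeWaveMode L k) Φ) X =
      ∑ j : Fin (m + 1), planeWaveMode L k (X j) * sliceCoef L k Φ (j.removeNth X) := by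
  rw [modeCr_apply, Finset.mul_sum]
  refine Finset.sum_congr rfl fun j _ => ?_
  rw [modeAn_apply]
  change ((Real.sqrt (m + 1) : ℝ) : ℂ)⁻¹ * (planeWaveMode L k (X j) *
    (((Real.sqrt (m + 1) : ℝ) : ℂ) * sliceCoef L k Φ (j.removeNth X))) = _
  rw [mul_left_comm (planeWaveMode L k (X j)), ← mul_assoc, inv_mul_cancel₀ (sqrt_cast_ne_zero m),
    one_mul]

/-- `aΦ = √(m+1) · h`. -/
theorem modeAn_eq_sqrt_mul_sliceCoef (L : ℝ) (k : Fin 3 → ℤ) (Φ : Config (m + 1) → ℂ) (Y : Config m) :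
    modeAn L (planeWaveMode L k) Φ Y = ((Real.sqrt (m + 1) : ℝ) : ℂ) * sliceCoef L k Φ Y := rfl

/-- (1) `potRe_w(Φ, n̂Φ) = Re ∫ ∑_j G_j` (`Re` commutes with the Bochner integral of the integrable `∑_j G_j`). -/
theorem potRe_numOp_eq_re (hL : 0 < L) {w : ℝ → ℝ≥0∞} (hw : Measurable w)
    (hint : (∫⁻ z : Space, w ‖z‖) ≠ ⊤) (k : Fin 3 → ℤ) {Φ : Config (m + 1) → ℂ} (hΦ : Continuous Φ) :
    potRe w L Φ (modeCr (planeWaveMode L k) (modeAn L (planeWaveMode L k) Φ)) =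
      (∫ X in cellN (m + 1) L, ∑ j : Fin (m + 1), crossG w L k Φ j X).re := by
  have hI : Integrable (fun X => ∑ j : Fin (m + 1), crossG w L k Φ j X)
      (volume.restrict (cellN (m + 1) L)) :=
    integrable_finsetSum _ fun j _ => integrable_crossG hL hw hint k hΦ j
  have h := integral_re hI
  simp only [RCLike.re_to_complex] at h
  rw [← h, potRe]
  refine integral_congr_ae (Eventually.of_forall fun X => ?_)
  dsimp only
  rw [numOp_apply, Finset.mul_sum, Complex.re_sum, Finset.mul_sum, Complex.re_sum]
  refine Finset.sum_congr rfl fun j _ => ?_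
  rw [crossG, Complex.re_ofReal_mul]

/-- Moving particle `j` to the front is a relabelling: `X ∘ (cycleRange j)⁻¹ = (x_j :: X̂_j)`. [folklore] -/
private theorem comp_cycleRange_symm (j : Fin (m + 1)) (X : Config (m + 1)) :
    X ∘ (j.cycleRange).symm = Matrix.vecCons (X j) (j.removeNth X) := by
  funext i
  have h := congrFun (vecCons_self_removeNth_comp_cycleRange j X) (j.cycleRange.symm i)
  rw [Function.comp_apply, Equiv.apply_symm_apply] at h
  exact h.symm

/-- (2, pointwise) `G_j(X) = G_0(X ∘ (cycleRange j)⁻¹)` for a Bose-symmetric `Φ` (`W` is relabelling invariant). -/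
theorem crossG_eq_crossG_zero (w : ℝ → ℝ≥0∞) (L : ℝ) (k : Fin 3 → ℤ) {Φ : Config (m + 1) → ℂ}
    (hΦ : IsSymm Φ) (j : Fin (m + 1)) (X : Config (m + 1)) :
    crossG w L k Φ j X = crossG w L k Φ 0 (X ∘ (j.cycleRange).symm) := by
  unfold crossG
  rw [periodicInteraction_comp_perm, hΦ (j.cycleRange).symm X, comp_cycleRange_symm,
    Matrix.cons_val_zero, removeNth_zero_vecCons]

/-- (2) `∫ G_j = ∫ G_0` (relabelling invariance of the cell integral, TK2). -/
theorem integral_crossG_eq (w : ℝ → ℝ≥0∞) (L : ℝ) (k : Fin 3 → ℤ) {Φ : Config (m + 1) → ℂ}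
    (hΦ : IsSymm Φ) (j : Fin (m + 1)) :
    ∫ X in cellN (m + 1) L, crossG w L k Φ j X = ∫ X in cellN (m + 1) L, crossG w L k Φ 0 X :=
  calc ∫ X in cellN (m + 1) L, crossG w L k Φ j X
      = ∫ X in cellN (m + 1) L, crossG w L k Φ 0 (X ∘ (j.cycleRange).symm) :=
        integral_congr_ae (Eventually.of_forall fun X => crossG_eq_crossG_zero w L k hΦ j X)
    _ = ∫ X in cellN (m + 1) L, crossG w L k Φ 0 X := integral_cellN_comp_perm L _ _

/-! ## The outer integral over the spectators -/

/-- (5, outer integral) `∫_Y ∫_x G_0(x::Y) = ∫_Y W(Y) conj h(Y) h(Y) + ∑_b s_b`. -/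
theorem integral_integral_crossG_zero (hL : 0 < L) {w : ℝ → ℝ≥0∞} (hw : Measurable w)
    (hint : (∫⁻ z : Space, w ‖z‖) ≠ ⊤) (k : Fin 3 → ℤ) {Φ : Config (m + 1) → ℂ} (hΦ : Continuous Φ) :
    ∫ Y in cellN m L, ∫ x in cell L, crossG w L k Φ 0 (Matrix.vecCons x Y) =
      (∫ Y in cellN m L, ((periodicInteraction w L Y).toReal : ℂ) *
          (conj (sliceCoef L k Φ Y) * sliceCoef L k Φ Y)) +
        ∑ b : Fin m, mixCoef w L k Φ b := by
  have hae : ∀ᵐ Y ∂(volume.restrict (cellN m L)), periodicInteraction w L Y < ⊤ :=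
    ae_lt_top (measurable_periodicInteraction_tk hw L) (lintegral_cellN_periodicInteraction_ne_top hL hw hint m)
  have hc : Continuous fun Y : Config m => conj (sliceCoef L k Φ Y) * sliceCoef L k Φ Y :=
    (Complex.continuous_conj.comp (continuous_sliceCoef L k hΦ)).mul (continuous_sliceCoef L k hΦ)
  rw [integral_congr_ae (hae.mono fun Y hY => integral_cell_crossG_zero hL hw hint k hΦ hY.ne),
    integral_add (integrable_toReal_periodicInteraction_mul hL hw hint hc)
      (integrable_finsetSum _ fun b _ => integrable_innerI hL hw hint k hΦ b),
    integral_finsetSum _ fun b _ => integrable_innerI hL hw hint k hΦ b]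
  rfl

/-! ## The direct term: `(m+1) ∫_Y W |h|² = P_w[aΦ]` -/

/-- `(‖z‖₊²).toReal = ‖z‖²`. [folklore] -/
private theorem toReal_coe_nnnorm_sq (z : ℂ) : (((‖z‖₊ : ℝ≥0∞)) ^ 2).toReal = ‖z‖ ^ 2 := by
  rw [coe_nnnorm_sq_eq_ofReal, ENNReal.toReal_ofReal (sq_nonneg _)]

/-- `P_w[g] < ∞` for every continuous `g` when `w(|·|) ∈ L¹(ℝ³)` (`g` is bounded on the cell and `∫_{cell} W < ∞`). -/
theorem potForm_ne_top (hL : 0 < L) {w : ℝ → ℝ≥0∞} (hw : Measurable w) (hint : (∫⁻ z : Space, w ‖z‖) ≠ ⊤)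
    {g : Config M → ℂ} (hg : Continuous g) : potForm w L g ≠ ⊤ :=
  (lintegral_cellN_pot_sq_lt_top (lintegral_cellN_periodicInteraction_ne_top hL hw hint M) hg).ne

/-- `∫_Y W(Y) conj h(Y) h(Y) dY = ∫_Y W |h|²` (a real number). -/
theorem integral_toReal_mul_conj_mul_self {w : ℝ → ℝ≥0∞} (L : ℝ) (k : Fin 3 → ℤ) (Φ : Config (m + 1) → ℂ) :
    ∫ Y in cellN m L, ((periodicInteraction w L Y).toReal : ℂ) *
        (conj (sliceCoef L k Φ Y) * sliceCoef L k Φ Y) =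
      ((∫ Y in cellN m L, (periodicInteraction w L Y).toReal * ‖sliceCoef L k Φ Y‖ ^ 2 : ℝ) : ℂ) := by
  rw [← integral_complex_ofReal]
  refine integral_congr_ae (Eventually.of_forall fun Y => ?_)
  simp only [Complex.conj_mul', Complex.ofReal_mul, Complex.ofReal_pow]

/-- `P_w[aΦ] = (m+1) P_w[h]` (`aΦ = √(m+1) h`). -/
theorem potForm_modeAn_eq (w : ℝ → ℝ≥0∞) (L : ℝ) (k : Fin 3 → ℤ) (Φ : Config (m + 1) → ℂ) :
    potForm w L (modeAn L (planeWaveMode L k) Φ) = (m + 1 : ℝ≥0∞) * potForm w L (sliceCoef L k Φ) := by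
  unfold potForm
  rw [← lintegral_const_mul' _ _ (ENNReal.add_ne_top.2 ⟨ENNReal.natCast_ne_top m, ENNReal.one_ne_top⟩)]
  refine lintegral_congr fun Y => ?_
  rw [modeAn_eq_sqrt_mul_sliceCoef, nnnorm_sqrt_mul_sq, mul_left_comm]

/-- `(m+1) ∫_Y W |h|² = P_w[aΦ].toReal`. -/
theorem toReal_potForm_modeAn (hL : 0 < L) {w : ℝ → ℝ≥0∞} (hw : Measurable w)
    (hint : (∫⁻ z : Space, w ‖z‖) ≠ ⊤) (k : Fin 3 → ℤ) {Φ : Config (m + 1) → ℂ} (hΦ : Continuous Φ) :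
    (potForm w L (modeAn L (planeWaveMode L k) Φ)).toReal =
      (m + 1) * ∫ Y in cellN m L, (periodicInteraction w L Y).toReal * ‖sliceCoef L k Φ Y‖ ^ 2 := by
  have h1 : ((m : ℝ≥0∞) + 1).toReal = (m : ℝ) + 1 := by
    rw [← Nat.cast_succ, ENNReal.toReal_natCast, Nat.cast_succ]
  rw [integral_potReal hw (continuous_sliceCoef L k hΦ)
      (potForm_ne_top hL hw hint (continuous_sliceCoef L k hΦ)),
    potForm_modeAn_eq, ENNReal.toReal_mul, h1]

end PotCross

/-! ## P-a -/

/-- P-a (the cross term): `potRe_w(Φ, n̂Φ) = P[aΦ].toReal + (m+1) ∑_b Re s_b` for a core `(m+1)`-body `Φ`, integrable `w`,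
`P[Φ] < ∞` (relabelling symmetry TK2 makes the `m+1` terms of `n̂Φ = ∑_j φ(xⱼ) h(X̂ⱼ)` equal; then TK1, TK5). -/
theorem potRe_numOp (hL : 0 < L) {w : ℝ → ℝ≥0∞} (hw : Measurable w) (hint : (∫⁻ z : Space, w ‖z‖) ≠ ⊤) (k : Fin 3 → ℤ)
    {Φ : Config (m + 1) → ℂ} (hΦ : IsCore L Φ) (hP : potForm w L Φ ≠ ⊤) :
    potRe w L Φ (modeCr (planeWaveMode L k) (modeAn L (planeWaveMode L k) Φ)) =
      (potForm w L (modeAn L (planeWaveMode L k) Φ)).toReal + (m + 1) * ∑ b : Fin m, (mixCoef w L k Φ b).re := by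
  have _ := hP
  have hΦc : Continuous Φ := hΦ.contDiff.continuous
  rw [PotCross.potRe_numOp_eq_re hL hw hint k hΦc,
    integral_finsetSum _ (fun j _ => PotCross.integrable_crossG hL hw hint k hΦc j),
    Finset.sum_congr rfl fun j _ => PotCross.integral_crossG_eq w L k hΦ.symm j, Finset.sum_const,
    Finset.card_univ, Fintype.card_fin, nsmul_eq_mul,
    integral_cellN_succ L (PotCross.integrable_crossG hL hw hint k hΦc 0),
    PotCross.integral_integral_crossG_zero hL hw hint k hΦc, PotCross.integral_toReal_mul_conj_mul_self,
    PotCross.toReal_potForm_modeAn hL hw hint k hΦc]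
  have hc : ((m + 1 : ℕ) : ℂ) = ((m + 1 : ℝ) : ℂ) := by push_cast; rfl
  rw [hc, Complex.re_ofReal_mul, Complex.add_re, Complex.ofReal_re, Complex.re_sum, mul_add]

end Summit.AtomisticToContinuum.BoseEinsteinCondensation.Cruxes.PeriodicIRBound.LinearPhFloorWagner.WF

end

namespace Summit.AtomisticToContinuum.BoseEinsteinCondensation.Cruxes.PeriodicIRBound.LinearPhFloorWagner

/-- The registered sub-goal `stub_wfPotCross2` of the crux ledger: this file's headline lemma `WF.potRe_numOp`. -/
theorem stub_wfPotCross2 : WF.Pkg.PotCross2 :=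
  @WF.potRe_numOp

end Summit.AtomisticToContinuum.BoseEinsteinCondensation.Cruxes.PeriodicIRBound.LinearPhFloorWagner
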